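import Literature.Topology.FourManifolds.SymplecticElementaryMoves
import Mathlib.Algebra.BigOperators.Pi
import HarnessLib

/-!
# The integral stabiliser of a pair of coordinate Lagrangians, I: the admissible group

Topic `Literature/Topology/FourManifolds`; theorems only, over `SurfaceGroupHomology.lean` /
`SymplecticElementaryMoves.lean` (`symplForm = ν` on `ℤ^{ι × Bool}`, the moves `moveX`, `moveZ`,
`moveW`).  Fix a partition of the handles `t : ι → Bool` (`T₀ = {t = false}`, `T₊ = {t = true}`)
and the two COORDINATE LAGRANGIANS

  `Λ_A = span {δ_{aᵢ} : i}` (`v_{bᵢ} = 0` for all `i`),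
  `Λ_t = span {δ_{(i, t i)} : i}` (`v_{(i, ¬t i)} = 0` for all `i`),

which meet in `V = span {δ_{aᵢ} : i ∈ T₀}`.  (After a cut swap this is the pair of abelian shadows
of the two handlebody kernels of the standard genus-`3k` Heegaard splitting of `#ᵏ S¹×S²`, `T₀` the
handles carrying an `S¹×S²` summand.)  The ADMISSIBLE automorphisms are the isometries of `ν`
mapping `Λ_A` into `Λ_A` and `Λ_t` into `Λ_t`; in the basis `(a; b)` they are the matrices
`(A, AS; 0, A⁻ᵀ)` with `A` block upper triangular for `T₀ ⊂ T₀ ∪ T₊`, `S` symmetric with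
`S₊₊ = 0`.  This file:

* `exists_admSubgroup` — the admissible automorphisms form a subgroup (inverses via the
  Lagrangian property `Λ = Λ^⊥`: `symplForm_eq_zero_of_bCoords`, `symplForm_eq_zero_of_tCoords`,
  `apply_true_eq_symplForm`, `apply_false_eq_symplForm`);
* the compatible elementary moves are admissible: `moveZ_adm` (`t i = false ∨ t j = true`),
  `moveX_adm` (`t j = false`), `moveW_adm` (`t i = false ∨ t j = false`), `signFlip_adm`;
* `eq_sum_of_bCoords`, `eq_sum_T0_of_coords`, `map_eq_sum_T0`, `map_eq_sum` — coordinate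
  expansions of vectors of `Λ_A` and `V` and of their images.

Sequels: `SymplecticPairStabilizerBlocks.lean` (the two diagonal blocks), `…Generation.lean`.

## References

* H. Zieschang, E. Vogt, H.-D. Coldewey, *Surfaces and Planar Discontinuous Groups*, LNM 835
  (1980), §3.6 (3.6.9–3.6.12: `Sp(2g, ℤ)` and its elementary generators). [ZieschangVogtColdewey1980]
-/

noncomputable section

namespace Literature.Topology.FourManifolds

open Finset Matrix

variable {ι : Type*} [Fintype ι] [DecidableEq ι]

/-! ## The two coordinate Lagrangians are isotropic -/

omit [DecidableEq ι] in
/-- `Λ_A` is isotropic: vectors without `b`-coordinates pair to zero. [folklore] -/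
theorem symplForm_eq_zero_of_bCoords {u v : ι × Bool → ℤ} (hu : ∀ i, u (i, true) = 0)
    (hv : ∀ i, v (i, true) = 0) : symplForm u v = 0 := by
  rw [symplForm_apply]
  exact Finset.sum_eq_zero fun i _ => by rw [hu, hv]; ring

omit [DecidableEq ι] in
/-- `Λ_t` is isotropic: vectors supported on the letters `(i, t i)` pair to zero. [folklore] -/
theorem symplForm_eq_zero_of_tCoords (t : ι → Bool) {u v : ι × Bool → ℤ}
    (hu : ∀ i, u (i, !t i) = 0) (hv : ∀ i, v (i, !t i) = 0) : symplForm u v = 0 := by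
  rw [symplForm_apply]
  refine Finset.sum_eq_zero fun i _ => ?_
  have hu' := hu i
  have hv' := hv i
  cases h : t i
  · rw [h] at hu' hv'
    simp only [Bool.not_false] at hu' hv'
    rw [hu', hv']; ring
  · rw [h] at hu' hv'
    simp only [Bool.not_true] at hu' hv'
    rw [hu', hv']; ring

/-- Reading a `b`-coordinate with the form: `w_{bᵢ} = ν(δ_{aᵢ}, w)`. [folklore] -/
theorem apply_true_eq_symplForm (w : ι × Bool → ℤ) (i : ι) :
    w (i, true) = symplForm (Pi.single (i, false) (1 : ℤ)) w := by
  rw [symplForm_single_false_left, one_mul]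

/-- Reading an `a`-coordinate with the form: `w_{aᵢ} = -ν(δ_{bᵢ}, w)`. [folklore] -/
theorem apply_false_eq_symplForm (w : ι × Bool → ℤ) (i : ι) :
    w (i, false) = -symplForm (Pi.single (i, true) (1 : ℤ)) w := by
  rw [symplForm_single_true_left, one_mul, neg_neg]

/-! ## The admissible subgroup -/

/-- **The stabiliser of the pair `(Λ_A, Λ_t)` in `Sp(ν)` is a subgroup** of the `ℤ`-linear
automorphisms of `ℤ^{ι × Bool}`: the isometries `F` of `ν` with `F Λ_A ⊆ Λ_A` and `F Λ_t ⊆ Λ_t`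
(inverses stabilise the two Lagrangians because `Λ = Λ^⊥`). [folklore] -/
theorem exists_admSubgroup (t : ι → Bool) :
    ∃ A : Subgroup ((ι × Bool → ℤ) ≃ₗ[ℤ] (ι × Bool → ℤ)), ∀ F, F ∈ A ↔
      ((∀ u v, symplForm (F u) (F v) = symplForm u v) ∧
      (∀ v : ι × Bool → ℤ, (∀ i, v (i, true) = 0) → ∀ i, F v (i, true) = 0) ∧
      (∀ v : ι × Bool → ℤ, (∀ i, v (i, !t i) = 0) → ∀ i, F v (i, !t i) = 0)) := by
  let P : ((ι × Bool → ℤ) ≃ₗ[ℤ] (ι × Bool → ℤ)) → Prop := fun F =>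
    (∀ u v, symplForm (F u) (F v) = symplForm u v) ∧
    (∀ v : ι × Bool → ℤ, (∀ i, v (i, true) = 0) → ∀ i, F v (i, true) = 0) ∧
    (∀ v : ι × Bool → ℤ, (∀ i, v (i, !t i) = 0) → ∀ i, F v (i, !t i) = 0)
  refine ⟨{ carrier := setOf P, mul_mem' := ?_, one_mem' := ?_, inv_mem' := ?_ }, fun F => Iff.rfl⟩
  · rintro F G ⟨hFs, hFa, hFt⟩ ⟨hGs, hGa, hGt⟩
    refine ⟨fun u v => ?_, fun v hv i => ?_, fun v hv i => ?_⟩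
    · rw [linearEquiv_mul_apply, linearEquiv_mul_apply, hFs, hGs]
    · rw [linearEquiv_mul_apply]; exact hFa _ (hGa v hv) i
    · rw [linearEquiv_mul_apply]; exact hFt _ (hGt v hv) i
  · exact ⟨fun u v => rfl, fun v hv i => hv i, fun v hv i => hv i⟩
  · rintro F ⟨hFs, hFa, hFt⟩
    have h1 : ∀ w, F (F⁻¹ w) = w := fun w => F.apply_symm_apply w
    have hsym : ∀ u v, symplForm (F⁻¹ u) (F⁻¹ v) = symplForm u v := fun u v => by
      rw [← hFs (F⁻¹ u) (F⁻¹ v), h1, h1]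
    refine ⟨hsym, fun v hv i => ?_, fun v hv i => ?_⟩
    · rw [apply_true_eq_symplForm (F⁻¹ v) i, ← hFs _ (F⁻¹ v), h1]
      exact symplForm_eq_zero_of_bCoords (hFa _ (fun j => by simp)) hv
    · cases h : t i
      · simp only [Bool.not_false]
        rw [apply_true_eq_symplForm (F⁻¹ v) i, ← hFs _ (F⁻¹ v), h1]
        refine symplForm_eq_zero_of_tCoords t (hFt _ fun j => ?_) hv
        rw [Pi.single_apply, if_neg]
        intro hji
        rw [Prod.mk.injEq] at hji
        obtain ⟨rfl, h2⟩ := hji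
        rw [h] at h2
        exact absurd h2 (by decide)
      · simp only [Bool.not_true]
        rw [apply_false_eq_symplForm (F⁻¹ v) i, ← hFs _ (F⁻¹ v), h1, neg_eq_zero]
        refine symplForm_eq_zero_of_tCoords t (hFt _ fun j => ?_) hv
        rw [Pi.single_apply, if_neg]
        intro hji
        rw [Prod.mk.injEq] at hji
        obtain ⟨rfl, h2⟩ := hji
        rw [h] at h2
        exact absurd h2 (by decide)

/-! ## The compatible elementary moves are admissible -/

/-- `moveZ i j n` is admissible when `t i = false ∨ t j = true`. [folklore] -/
theorem moveZ_adm (t : ι → Bool) {i j : ι} (h : i ≠ j) (hij : t i = false ∨ t j = true) (n : ℤ) :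
    (∀ u v, symplForm (moveZ i j h n u) (moveZ i j h n v) = symplForm u v) ∧
    (∀ v : ι × Bool → ℤ, (∀ p, v (p, true) = 0) → ∀ p, moveZ i j h n v (p, true) = 0) ∧
    (∀ v : ι × Bool → ℤ, (∀ p, v (p, !t p) = 0) → ∀ p, moveZ i j h n v (p, !t p) = 0) := by
  refine ⟨symplForm_moveZ h n, fun v hv p => ?_, fun v hv p => ?_⟩
  · by_cases hpj : p = j
    · rw [hpj, moveZ_apply_true, hv, hv, mul_zero, sub_zero]
    · rw [moveZ_apply_of_ne h n v (by simp) (by simpa using hpj), hv]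
  · have hvp := hv p
    cases htp : t p
    · rw [htp] at hvp
      simp only [Bool.not_false] at hvp ⊢
      by_cases hpj : p = j
      · have hvi : v (i, true) = 0 := by
          rcases hij with h' | h'
          · simpa [h'] using hv i
          · rw [← hpj, htp] at h'; exact absurd h' (by decide)
        rw [hpj] at hvp ⊢
        rw [moveZ_apply_true, hvp, hvi, mul_zero, sub_zero]
      · rw [moveZ_apply_of_ne h n v (by simp) (by simpa using hpj), hvp]
    · rw [htp] at hvp
      simp only [Bool.not_true] at hvp ⊢
      by_cases hpi : p = i
      · have hvj : v (j, false) = 0 := by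
          rcases hij with h' | h'
          · rw [← hpi, htp] at h'; exact absurd h' (by decide)
          · simpa [h'] using hv j
        rw [hpi] at hvp ⊢
        rw [moveZ_apply_false, hvp, hvj, mul_zero, add_zero]
      · rw [moveZ_apply_of_ne h n v (by simpa using hpi) (by simp), hvp]

/-- `moveX j n` is admissible when `t j = false`. [folklore] -/
theorem moveX_adm (t : ι → Bool) {j : ι} (hj : t j = false) (n : ℤ) :
    (∀ u v, symplForm (moveX j n u) (moveX j n v) = symplForm u v) ∧
    (∀ v : ι × Bool → ℤ, (∀ p, v (p, true) = 0) → ∀ p, moveX j n v (p, true) = 0) ∧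
    (∀ v : ι × Bool → ℤ, (∀ p, v (p, !t p) = 0) → ∀ p, moveX j n v (p, !t p) = 0) := by
  refine ⟨symplForm_moveX j n, fun v hv p => by rw [moveX_apply_true, hv], fun v hv p => ?_⟩
  have hvp := hv p
  cases htp : t p
  · rw [htp] at hvp
    simp only [Bool.not_false] at hvp ⊢
    rw [moveX_apply_true, hvp]
  · rw [htp] at hvp
    simp only [Bool.not_true] at hvp ⊢
    have hpj : p ≠ j := by rintro rfl; rw [htp] at hj; exact absurd hj (by decide)
    rw [moveX_apply_of_ne j n v (by simpa using hpj), hvp]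

/-- `moveW i j n` is admissible when `t i = false ∨ t j = false`. [folklore] -/
theorem moveW_adm (t : ι → Bool) {i j : ι} (h : i ≠ j) (hij : t i = false ∨ t j = false) (n : ℤ) :
    (∀ u v, symplForm (moveW i j n u) (moveW i j n v) = symplForm u v) ∧
    (∀ v : ι × Bool → ℤ, (∀ p, v (p, true) = 0) → ∀ p, moveW i j n v (p, true) = 0) ∧
    (∀ v : ι × Bool → ℤ, (∀ p, v (p, !t p) = 0) → ∀ p, moveW i j n v (p, !t p) = 0) := by
  refine ⟨symplForm_moveW h n, fun v hv p => by rw [moveW_apply_true, hv], fun v hv p => ?_⟩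
  have hvp := hv p
  cases htp : t p
  · rw [htp] at hvp
    simp only [Bool.not_false] at hvp ⊢
    rw [moveW_apply_true, hvp]
  · rw [htp] at hvp
    simp only [Bool.not_true] at hvp ⊢
    by_cases hpi : p = i
    · have hvj : v (j, true) = 0 := by
        rcases hij with h' | h'
        · rw [← hpi, htp] at h'; exact absurd h' (by decide)
        · simpa [h'] using hv j
      rw [hpi] at hvp ⊢
      rw [moveW_apply_false_left h, hvp, hvj, mul_zero, add_zero]
    · by_cases hpj : p = j
      · have hvi : v (i, true) = 0 := by
          rcases hij with h' | h'
          · simpa [h'] using hv i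
          · rw [← hpj, htp] at h'; exact absurd h' (by decide)
        rw [hpj] at hvp ⊢
        rw [moveW_apply_false_right h, hvp, hvi, mul_zero, add_zero]
      · rw [moveW_apply_of_ne i j n v (by simpa using hpj) (by simpa using hpi), hvp]

/-- The sign change `E` of handle `k` (`(E v)_p = ± v_p`, sign `-` on handle `k`) is admissible.
[folklore] -/
theorem signFlip_adm (t : ι → Bool) (k : ι) (E : (ι × Bool → ℤ) ≃ₗ[ℤ] (ι × Bool → ℤ))
    (hE : ∀ v p, E v p = (if p.1 = k then -1 else 1) * v p) :
    (∀ u v, symplForm (E u) (E v) = symplForm u v) ∧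
    (∀ v : ι × Bool → ℤ, (∀ p, v (p, true) = 0) → ∀ p, E v (p, true) = 0) ∧
    (∀ v : ι × Bool → ℤ, (∀ p, v (p, !t p) = 0) → ∀ p, E v (p, !t p) = 0) := by
  refine ⟨fun u v => ?_, fun v hv p => by rw [hE, hv, mul_zero], fun v hv p => by rw [hE, hv, mul_zero]⟩
  rw [symplForm_apply, symplForm_apply]
  refine Finset.sum_congr rfl fun i _ => ?_
  simp only [hE]
  split_ifs <;> ring

/-! ## Coordinate expansions -/

omit [DecidableEq ι] in
/-- A vector without `b`-coordinates is the combination of the `δ_{aᵢ}` with its `a`-coordinates.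
[folklore] -/
theorem eq_sum_of_bCoords [DecidableEq ι] {w : ι × Bool → ℤ} (hw : ∀ i, w (i, true) = 0) :
    w = ∑ i, w (i, false) • (Pi.single (i, false) (1 : ℤ) : ι × Bool → ℤ) := by
  conv_lhs => rw [pi_eq_sum_univ' w, Fintype.sum_prod_type]
  refine Finset.sum_congr rfl fun i _ => ?_
  rw [Fintype.sum_bool, hw, zero_smul, zero_add]

/-- A vector of `V = Λ_A ∩ Λ_t` is the combination of the `δ_{aᵢ}`, `i ∈ T₀`. [folklore] -/
theorem eq_sum_T0_of_coords (t : ι → Bool) {w : ι × Bool → ℤ} (hw : ∀ i, w (i, true) = 0)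
    (hw' : ∀ i, t i = true → w (i, false) = 0) :
    w = ∑ p : {i // t i = false}, w (p.1, false) • (Pi.single (p.1, false) (1 : ℤ) : ι × Bool → ℤ) := by
  conv_lhs => rw [eq_sum_of_bCoords hw]
  rw [← Finset.sum_subtype (Finset.univ.filter fun i => t i = false) (by simp)
    (fun i => w (i, false) • (Pi.single (i, false) (1 : ℤ) : ι × Bool → ℤ))]
  rw [Finset.sum_filter]
  refine Finset.sum_congr rfl fun i _ => ?_
  cases h : t i
  · simp
  · simp [hw' i h]

/-- `F w` for `w ∈ V`: `F w = ∑_{r ∈ T₀} w_{a_r} F δ_{a_r}`. [folklore] -/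
theorem map_eq_sum_T0 (t : ι → Bool) (F : (ι × Bool → ℤ) ≃ₗ[ℤ] (ι × Bool → ℤ)) {w : ι × Bool → ℤ}
    (hw : ∀ i, w (i, true) = 0) (hw' : ∀ i, t i = true → w (i, false) = 0) (x : ι × Bool) :
    F w x = ∑ r : {i // t i = false}, w (r.1, false) * F (Pi.single (r.1, false) 1) x := by
  conv_lhs => rw [eq_sum_T0_of_coords t hw hw', map_sum]
  rw [Finset.sum_apply]
  refine Finset.sum_congr rfl fun r _ => ?_
  rw [map_smul, Pi.smul_apply, smul_eq_mul]

/-- `F w` for `w ∈ Λ_A`: `F w = ∑_r w_{a_r} F δ_{a_r}`. [folklore] -/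
theorem map_eq_sum (F : (ι × Bool → ℤ) ≃ₗ[ℤ] (ι × Bool → ℤ)) {w : ι × Bool → ℤ}
    (hw : ∀ i, w (i, true) = 0) (x : ι × Bool) :
    F w x = ∑ r, w (r, false) * F (Pi.single (r, false) 1) x := by
  conv_lhs => rw [eq_sum_of_bCoords hw, map_sum]
  rw [Finset.sum_apply]
  refine Finset.sum_congr rfl fun r _ => ?_
  rw [map_smul, Pi.smul_apply, smul_eq_mul]

end Literature.Topology.FourManifolds

end
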